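import Literature.NumberTheory.PAdicHodge.BdRPlusLogTeichKernelUniform
import HarnessLib

/-!
# The correction cochain of an `X⁰₂`-valued cochain killed by `θ` is CONTINUOUS: `p · E ≡ ι ∘ h (mod Fil²)` with `h ∈ C(Γ_F, ℤ_p(1))`

Topic `Literature/NumberTheory/PAdicHodge`; namespace `Literature.NumberTheory.PAdicHodge.GaloisContinuity`. THEOREMS ONLY (no definition,
no named fact, no instance, no `sorry`). Sequel of `BdRPlusLogTeichKernelUniform` (§3: a cochain `E : Γ_F → B_dR⁺(F)` whose values are
Teichmüller logarithms modulo `Fil²` killed by `θ` satisfies `p · E(σ) − ι(h σ) ∈ Fil²` for a UNIQUE `h : Γ_F → ℤ_p(1)`, and `h` inherits the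
algebraic identities of `E`). Here the remaining hypothesis of the assembly socket `ReciprocityCalibrationSocket.tatePairingPoint_eq_neg_trace_of_recognition`
— CONTINUITY of `h` — is derived from two further properties of `E`:

* (small) `p`-adic smallness near `1`: for every `N`, `E(σ) ∈ p^N · X⁰₂ + Fil²` for all `σ` in a neighbourhood of `1` (supplied, for
  the cochains of the line, by `BdRPlusLogTeichGalois`: continuity of the coefficients and `p`-adic Galois continuity on `X⁰₂`);
* (coch) a twisted cochain identity `E(στ) = E(σ) + σ E(τ) + ι(d(σ, τ))` with `τ ↦ d(σ, τ)` continuous for each `σ` (for a presenting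
  cochain minus a calibration cochain, `d` is minus the difference of the presented `2`-cocycles).

* §1 ★ `norm_epsLineEquiv_symm_le_of_sub_pow_mul_mem` — (small) forces **`h(σ) ∈ p^N ℤ_p(1)`**: `E(σ) = p^N L' + Fil²` with `θ(L') = 0`
  (`ℂ_F` is torsion-free), so `p L' ≡ a t` (UNIFORM kernel) and `p E(σ) ≡ p^N a · t`, whence `h(σ) = ε^{p^N a}` (uniqueness).
* §2 ★ `continuous_of_cochain_identity_of_continuousAt_one` (pure topology, `ℤ_p`-coordinates): a map `h' : Γ → ℤ_p` with
  `h'(στ) = h'(σ) + c(σ) h'(τ) + r(σ, τ)`, `r(σ, ·)` continuous at `1`, and `h'` continuous at `1`, is continuous (left translation is a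
  homeomorphism).
* §3 ★★ `exists_continuous_periodLine_sub_mem_sq` — **under (small) and (coch), `p · E(σ) − ι(h σ) ∈ Fil² B_dR⁺` for a CONTINUOUS
  `h : C(Γ_F, ℤ_p(1)(F̄))`** — verbatim the datum `h` of the socket.

Use (line `kato_lever` of crux K★ `stmt-BirchSwinnertonDyer-22226`, (H4) step (3); memo `Lines/kato-lever-K3-legendre.md`): with
`TatePairingCochainLegendre` (presentation), `BdRPlusLogTeichUnit` (the calibration term is a Teichmüller logarithm) and
`BdRPlusLogTeichGalois` (smallness), the explicit reciprocity law at a completion is reduced to the `X₂`-membership of the two elements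
`x̃(v₀), x̃(v₁)` and the Hodge–Tate reading of `exp*`. Infrastructure only; BSD / K★ / [REC] are NOT proved by any of this.

## References
* K. Kato, LNM 1553 (1993), Ch. II §1.2.5 (topologies), proof of Lemma 1.4.3 (the cochain comparison in `X`). [Kato1993LNM1553]
* J. Neukirch, A. Schmidt, K. Wingberg (2008), I §3 (1.3.2), II §7 (continuous cochains). [NeukirchSchmidtWingberg2008]
* J.-M. Fontaine, Y. Ouyang, *Theory of p-adic Galois representations*, §6.1. [FontaineOuyang2022]
-/

noncomputable section

namespace Literature.NumberTheory.PAdicHodge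

namespace GaloisContinuity

open ValuativeRel Field Ideal WittVector _root_.Topology _root_.Filter
open Literature.NumberTheory.GaloisRepresentations Literature.NumberTheory.GaloisRepresentations.IsNonarchimedeanLocalField
open Literature.NumberTheory.GaloisCohomology
open BdRPlusTop

variable {F : Type} [Field F] [ValuativeRel F] [TopologicalSpace F] [IsNonarchimedeanLocalField F]
  [CharZero F] {p : ℕ} [Fact p.Prime] [Fact (¬ IsUnit (p : integerC F))]
  [IsAdicComplete (Ideal.span {(p : integerC F)}) (integerC F)]

/-! ## §1 Smallness of `E` near `1` forces `p^N ∣ h` -/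

/-- ★ **`E(σ) ∈ p^N X⁰₂ + Fil²` and `θ(E σ) = 0` force `h(σ) ∈ p^N ℤ_p(1)`.** If `E − p^N L' ∈ ξ² B_dR⁺` with `L'` a Teichmüller logarithm,
`θ(E) = 0`, and `p · E − ι(ζ) ∈ Fil²`, then `‖log_ε ζ‖ ≤ p^{-N}`: `θ(L') = 0` (`θ(Fil²) = 0`, `p^N ≠ 0` in `ℂ_F`), so `p L' − a t ∈ Fil²`
(uniform kernel), `p E − p^N a · t ∈ Fil²`, and `ζ = ε^{p^N a}` by uniqueness. [cite: FontaineOuyang2022, §6.1] [cite: Kato1993LNM1553, Ch. II §1.4] -/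
theorem norm_epsLineEquiv_symm_le_of_sub_pow_mul_mem (hp : valuation F p < 1)
    (hF : Function.Surjective (fontaineTheta (integerC F) p)) {E L' : BDeRhamPlus (integerC F) p} {N : ℕ}
    (hL' : IsTeichLog 2 L') (hEL : E - (p : BDeRhamPlus (integerC F) p) ^ N * L' ∈ Ideal.span {(xiBdR : BDeRhamPlus (integerC F) p) ^ 2})
    (h0 : thetaBdR E = 0) {ζ : (muPadicSystem F p).limit}
    (hζ : (p : BdRPlusTop F p) * BdRPlusTop.of F p E - periodLine F p ζ ∈ (WithIdeal.i ^ 2 : Ideal (BdRPlusTop F p))) :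
    ‖(epsLineEquiv F p).symm ζ‖ ≤ (p : ℝ) ^ (-(N : ℤ)) := by
  haveI : CharZero (CompletedAlgClosure F) := charZero_of_injective_algebraMap (algebraMap F (CompletedAlgClosure F)).injective
  -- `θ(L') = 0`
  have hθL : thetaBdR L' = 0 := by
    have h1 : thetaBdR (E - (p : BDeRhamPlus (integerC F) p) ^ N * L') = 0 := thetaBdR_eq_zero_of_mem_span_xiBdR_pow (by norm_num) hEL
    rw [map_sub, h0, map_mul, map_pow, map_natCast, zero_sub, neg_eq_zero] at h1
    exact (mul_eq_zero.1 h1).resolve_left (pow_ne_zero N (natCast_C_ne_zero (Fact.out : p.Prime).ne_zero))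
  -- uniform kernel: `p L' − a t ∈ Fil²`
  obtain ⟨a, ha⟩ := hL'.exists_prime_mul_sub_mul_tBdR_mem hp (by norm_num) hθL
  -- `p E − p^N a · t ∈ Fil²`
  have hmem : (p : BdRPlusTop F p) * BdRPlusTop.of F p E - periodLine F p (epsLineEquiv F p ((p : ℤ_[p]) ^ N * a)) ∈
      (WithIdeal.i ^ 2 : Ideal (BdRPlusTop F p)) := by
    have e : (p : BDeRhamPlus (integerC F) p) * E - qpToBdR (((p : ℤ_[p]) ^ N * a : ℤ_[p]) : ℚ_[p]) * tBdR =
        (p : BDeRhamPlus (integerC F) p) * (E - (p : BDeRhamPlus (integerC F) p) ^ N * L') +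
          (p : BDeRhamPlus (integerC F) p) ^ N * ((p : BDeRhamPlus (integerC F) p) * L' - qpToBdR (a : ℚ_[p]) * tBdR) := by
      rw [PadicInt.coe_mul, PadicInt.coe_pow, PadicInt.coe_natCast, map_mul, map_pow, map_natCast]; ring
    rw [periodLine_epsLineEquiv, ← (BdRPlusTop.of F p).apply_symm_apply ((p : BdRPlusTop F p) * BdRPlusTop.of F p E),
      map_mul, map_natCast, RingEquiv.symm_apply_apply, ← map_sub, of_mem_ideal_pow_iff, e]
    exact Ideal.add_mem _ (Ideal.mul_mem_left _ _ hEL) (Ideal.mul_mem_left _ _ ha)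
  have heq := periodLine_unique_mod_pow hp hF (le_refl 2) hζ hmem
  rw [heq, AddEquiv.symm_apply_apply, PadicInt.norm_le_pow_iff_mem_span_pow, Ideal.mem_span_singleton']
  exact ⟨a, by ring⟩

/-! ## §2 Continuity from continuity at `1` and a twisted cochain identity -/

/-- ★ **Continuity from the identity `h'(στ) = h'(σ) + c(σ) h'(τ) + r(σ, τ)`.** Let `Γ` be a topological group and `h' : Γ → ℤ_p` with
`h'(στ) = h'(σ) + c(σ) · h'(τ) + r(σ, τ)` for all `σ, τ`, where each `r(σ, ·)` is continuous at `1`; if `h'` is continuous at `1` then `h'` is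
continuous (the identity at `τ = 1` reads `c(σ) h'(1) + r(σ, 1) = 0`; left translation by `σ` is a homeomorphism).
[cite: NeukirchSchmidtWingberg2008, II §7] -/
theorem continuous_of_cochain_identity_of_continuousAt_one {Γ : Type*} [TopologicalSpace Γ] [Group Γ] [IsTopologicalGroup Γ]
    {h' : Γ → ℤ_[p]} {c : Γ → ℤ_[p]} {r : Γ → Γ → ℤ_[p]} (hid : ∀ σ τ, h' (σ * τ) = h' σ + c σ * h' τ + r σ τ)
    (hr : ∀ σ, ContinuousAt (r σ) 1) (h1 : ContinuousAt h' 1) : Continuous h' := by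
  refine continuous_iff_continuousAt.2 fun σ₀ => ?_
  have e : h' ∘ (Homeomorph.mulLeft σ₀) = fun τ => h' σ₀ + c σ₀ * h' τ + r σ₀ τ := by
    funext τ
    rw [Function.comp_apply, Homeomorph.coe_mulLeft, hid]
  have hc : ContinuousAt (fun τ => h' σ₀ + c σ₀ * h' τ + r σ₀ τ) 1 :=
    (continuousAt_const.add (continuousAt_const.mul h1)).add (hr σ₀)
  rw [← e, Homeomorph.comp_continuousAt_iff'] at hc
  simpa only [Homeomorph.coe_mulLeft, mul_one] using hc

/-- **Continuity at `1` from `p^N`-divisibility near `1`**: if for every `N`, `‖h'(σ)‖ ≤ p^{-N}` for `σ` near `1`, then `h'(1) = 0` and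
`h'` is continuous at `1`. [cite: NeukirchSchmidtWingberg2008, II §7] -/
theorem continuousAt_one_of_eventually_norm_le {Γ : Type*} [TopologicalSpace Γ] [One Γ] {h' : Γ → ℤ_[p]}
    (hsmall : ∀ N : ℕ, ∀ᶠ σ in 𝓝 (1 : Γ), ‖h' σ‖ ≤ (p : ℝ) ^ (-(N : ℤ))) : h' 1 = 0 ∧ ContinuousAt h' 1 := by
  have hp1 : (1 : ℝ) < p := by exact_mod_cast (Fact.out : p.Prime).one_lt
  have h10 : h' 1 = 0 := by
    by_contra hne
    have hpos : 0 < ‖h' 1‖ := norm_pos_iff.2 hne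
    obtain ⟨N, hN⟩ : ∃ N : ℕ, (p : ℝ) ^ (-(N : ℤ)) < ‖h' 1‖ := by
      obtain ⟨N, hN⟩ := exists_pow_lt_of_lt_one hpos (inv_lt_one_of_one_lt₀ hp1)
      exact ⟨N, by rwa [zpow_neg, zpow_natCast, ← inv_pow]⟩
    exact absurd ((hsmall N).self_of_nhds) (not_le.2 hN)
  refine ⟨h10, Metric.continuousAt_iff'.2 fun ε hε => ?_⟩
  obtain ⟨N, hN⟩ : ∃ N : ℕ, (p : ℝ) ^ (-(N : ℤ)) < ε := by
    obtain ⟨N, hN⟩ := exists_pow_lt_of_lt_one hε (inv_lt_one_of_one_lt₀ hp1)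
    exact ⟨N, by rwa [zpow_neg, zpow_natCast, ← inv_pow]⟩
  refine (hsmall N).mono fun σ hσ => ?_
  rw [dist_eq_norm, h10, sub_zero]
  exact hσ.trans_lt hN

/-! ## §3 The continuous correction cochain -/

/-- ★★ **The correction cochain is continuous.** Let `E : Γ_F → B_dR⁺(F)` take Teichmüller-logarithm values modulo `Fil²` killed by `θ`
(`hE`, `h0`), be `p`-adically small near `1` (`hsmall`: for every `N`, `E(σ) ∈ p^N X⁰₂ + Fil²` for `σ` near `1`) and satisfy the twisted
cochain identity `E(στ) = E(σ) + σ E(τ) + ι(d(σ, τ))` with each `d(σ, ·)` continuous. Then **there is a CONTINUOUS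
`h : Γ_F → ℤ_p(1)(F̄)` with `p · E(σ) − ι(h σ) ∈ Fil² B_dR⁺` for all `σ`** — the datum `h` of the assembly socket
`ReciprocityCalibrationSocket.tatePairingPoint_eq_neg_trace_of_recognition`. [cite: Kato1993LNM1553, Ch. II §1.2.5 and proof of Lemma 1.4.3]
[cite: NeukirchSchmidtWingberg2008, I §3 (1.3.2), II §7] -/
theorem exists_continuous_periodLine_sub_mem_sq (hp : valuation F p < 1) (hF : Function.Surjective (fontaineTheta (integerC F) p))
    (E : absoluteGaloisGroup F → BdRPlusTop F p) (hE : ∀ σ, IsTeichLog 2 ((BdRPlusTop.of F p).symm (E σ)))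
    (h0 : ∀ σ, thetaBdR ((BdRPlusTop.of F p).symm (E σ)) = 0)
    (hsmall : ∀ N : ℕ, ∀ᶠ σ in 𝓝 (1 : absoluteGaloisGroup F), ∃ L' : BDeRhamPlus (integerC F) p,
      IsTeichLog 2 L' ∧ (BdRPlusTop.of F p).symm (E σ) - (p : BDeRhamPlus (integerC F) p) ^ N * L' ∈
        Ideal.span {(xiBdR : BDeRhamPlus (integerC F) p) ^ 2})
    (d : absoluteGaloisGroup F → absoluteGaloisGroup F → (muPadicSystem F p).limit) (hd : ∀ σ, Continuous (d σ))
    (hcoch : ∀ σ τ, E (σ * τ) = E σ + galRepr F p σ (E τ) + periodLine F p (d σ τ)) :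
    ∃ h : C(absoluteGaloisGroup F, (muPadicSystem F p).limit),
      ∀ σ, (p : BdRPlusTop F p) * E σ - periodLine F p (h σ) ∈ (WithIdeal.i ^ 2 : Ideal (BdRPlusTop F p)) := by
  obtain ⟨h, hh⟩ := exists_periodLine_sub_mem_sq_of_isTeichLog hp E hE h0
  -- the identity passes to `h`: `h(στ) = h σ + σ h τ + p • d σ τ`
  have hid : ∀ σ τ, h (σ * τ) = h σ + tateModuleMuPadic F p σ (h τ) + (p : ℤ) • d σ τ := fun σ τ =>
    sub_periodLine_cochain_identity hp hF (hh σ) (hh τ) (hh (σ * τ)) (galRepr F p σ).toAddMonoidHom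
      (fun b hb => gal_mem_ideal_pow σ 2 hb) (fun b => by simp only [LinearMap.toAddMonoidHom_coe, galRepr_apply, map_mul, map_natCast])
      ((tateModuleMuPadic F p σ : (muPadicSystem F p).limit →ₗ[ℤ] (muPadicSystem F p).limit)).toAddMonoidHom
      (fun ζ => by rw [LinearMap.toAddMonoidHom_coe, LinearMap.toAddMonoidHom_coe, periodLine_tateModuleMuPadic_eq_galRepr])
      (hcoch σ τ)
  -- `ℤ_p`-coordinates
  set h' : absoluteGaloisGroup F → ℤ_[p] := fun σ => (epsLineEquiv F p).symm (h σ) with hh'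
  have hid' : ∀ σ τ, h' (σ * τ) = h' σ + ((GaloisRep.cyclotomicCharacter F p σ : ℤ_[p]ˣ) : ℤ_[p]) * h' τ +
      (epsLineEquiv F p).symm ((p : ℤ) • d σ τ) := fun σ τ => by
    simp only [hh', hid, map_add, epsLineEquiv_symm_tateModuleMuPadic]
  -- smallness near `1`
  have hsmall' : ∀ N : ℕ, ∀ᶠ σ in 𝓝 (1 : absoluteGaloisGroup F), ‖h' σ‖ ≤ (p : ℝ) ^ (-(N : ℤ)) := fun N =>
    (hsmall N).mono fun σ ⟨L', hL', hEL⟩ => by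
      refine norm_epsLineEquiv_symm_le_of_sub_pow_mul_mem hp hF hL' hEL (h0 σ) ?_
      rw [RingEquiv.apply_symm_apply]; exact hh σ
  obtain ⟨_, h1⟩ := continuousAt_one_of_eventually_norm_le hsmall'
  have hr : ∀ σ, ContinuousAt (fun τ => (epsLineEquiv F p).symm ((p : ℤ) • d σ τ)) 1 := fun σ =>
    ((continuous_padicLineEquiv_symm _ _).comp ((hd σ).const_smul (p : ℤ))).continuousAt
  have hcont' : Continuous h' := continuous_of_cochain_identity_of_continuousAt_one hid' hr h1
  have hcont : Continuous h := (continuous_iff_continuous_epsLineEquiv_symm_comp h).2 hcont'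
  exact ⟨⟨h, hcont⟩, hh⟩

end GaloisContinuity

end Literature.NumberTheory.PAdicHodge

end
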